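import Literature.NumberTheory.Sieve.VinogradovExpSum
import HarnessLib

/-!
# Exponential sums over the Möbius function: the Davenport–Vaughan minor-arc bound

Topic `Literature/NumberTheory/Sieve` (circle method). Everything in this file is PROVED
(theorems only; no definitions, no named facts).

The classical estimate (Davenport 1937; in Vaughan's form, e.g. Iwaniec–Kowalski Thm 13.9,
Montgomery–Vaughan; quoted by B. Green, *On (not) computing the Möbius function using bounded
depth circuits*, CPC 21 (2012), §4 Proposition 4 [Green2012] as "a standard estimate on
exponential sums over the Möbius function … perhaps most easily by utilising Vaughan's identity"):
for `|α − a/q| ≤ q⁻²`, `(a, q) = 1`, `1 ≤ q ≤ N`,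

  `‖∑_{n ≤ N} μ(n) e(nα)‖ ≤ C (N q^{-1/2} + N^{9/10} + N^{1/2} q^{1/2}) (log N)⁴`

(`MoebiusExpSum.norm_afExpSum_moebius_le`; the middle term is `N^{4/5}` in the sharpest
textbook form — any power saving suffices for the applications), and its inverse form, Green's
Proposition 4 (`MoebiusExpSum.exists_rat_near_of_le_norm_afExpSum`): if
`‖∑_{n ≤ N} μ(n)e(nθ)‖ ≥ δN` then `θ` is within `C(log N/δ)^A/N` of a rational with denominator
`≤ C(log N/δ)^A`.

## The proof (Vaughan's identity for `μ`, Nathanson GTM 164 §8.5 adapted)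

With `μ_u` the truncation of `μ` to `[1, u]` (`Literature.NumberTheory.Sieve.moebiusTrunc`) and
`G_u = (μ − μ_u) * ζ` (`Literature.NumberTheory.Sieve.Vaughan.gU`, `|G_u| ≤ τ`, `G_u = 0` on
`[1, u]`), Möbius inversion `μ * ζ = 1` gives the three-term identity
`μ = 2μ_u − μ_u * μ_u * ζ + G_u * (μ − μ_u)` (`moebius_eq_three_terms`). Summed against `e(nα)`:
* `∑ μ_u(n) e(nα)` is trivially `≤ u`;
* the type I sum `∑_{k ≤ u²} (μ_u * μ_u)(k) ∑_{m ≤ N/k} e(αkm)` has divisor-bounded coefficients;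
  Cauchy–Schwarz with `∑_{k ≤ U} τ(k)²/k ≤ (1 + log U)⁴` (`sum_sq_card_divisors_div_le`) and the
  tree's Lemma 4.10 `sum_geomBound_div_le` give `≪ (log)³ √N (N/q + u² + q)^{1/2}`
  (`norm_typeI_le`);
* the type II sum `∑_{k > u} G_u(k) ∑_{u < ℓ ≤ N/k} μ(ℓ) e(αkℓ)` is Nathanson's Lemma 8.8 with
  `Λ − Λ_u` replaced by `μ − μ_u` (bounded by `1 ≤ 2 log N`): the tree's generic mean square
  `typeII_sum_norm_sq_le`, Cauchy–Schwarz with `∑ τ² ≤ x(1 + log x)³`, dyadic blocks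
  (`norm_typeII_block_le`, `norm_typeII_le`): `≤ 512 (log N)⁴ (N/√q + 2N/√u + √N√q)`;
* `u = ⌊N^{2/5}⌋` (`norm_afExpSum_moebius_le`).
The inverse form follows with Dirichlet's approximation theorem
(`Real.exists_rat_abs_sub_le_and_den_le`).

## References
* [Green2012] B. Green, CPC 21 (2012) 942–951, §4 Proposition 4.
* [Nathanson1996] M. B. Nathanson, *Additive Number Theory: the Classical Bases*, GTM 164, §8.5.
* H. Davenport, Quart. J. Math. 8 (1937) 313–320; H. Iwaniec, E. Kowalski, *Analytic Number
  Theory*, Thm 13.9.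
-/

noncomputable section

open Finset Real ArithmeticFunction
open scoped FourierTransform ArithmeticFunction.Moebius ArithmeticFunction.zeta
  ArithmeticFunction.sigma

namespace Literature.NumberTheory.Sieve.MoebiusExpSum

open Literature.NumberTheory.Sieve.Vinogradov
open Literature.NumberTheory.Sieve.Vaughan (gU arith_sub_apply gU_eq_zero_of_le abs_gU_le
  sum_sq_card_divisors_le sum_card_divisors_div_le card_divisors_mul_le
  card_divisors_eq_sum_antidiagonal sum_Ioc_sum_divisorsAntidiagonal_eq log_le_log_of_le)

/-! ### The three-term Vaughan identity for `μ` -/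

/-- **Vaughan's identity for the Möbius function** (three terms): with `μ_u` the truncation of
`μ` to `[1, u]` and `G_u = (μ − μ_u) * ζ`,
`μ = μ_u + μ_u − μ_u * μ_u * ζ + G_u * (μ − μ_u)` (expand and use `μ * ζ = 1`).
[cite: Nathanson1996, §8.5 (Vaughan's identity); Green2012, §4 Proposition 4] -/
theorem moebius_eq_three_terms (u : ℕ) :
    (μ : ArithmeticFunction ℝ) =
      (Literature.NumberTheory.Sieve.moebiusTrunc u : ArithmeticFunction ℝ) +
        (Literature.NumberTheory.Sieve.moebiusTrunc u : ArithmeticFunction ℝ) -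
        (Literature.NumberTheory.Sieve.moebiusTrunc u : ArithmeticFunction ℝ) *
          (Literature.NumberTheory.Sieve.moebiusTrunc u : ArithmeticFunction ℝ) *
            (ζ : ArithmeticFunction ℝ) +
        gU u * ((μ : ArithmeticFunction ℝ) -
          (Literature.NumberTheory.Sieve.moebiusTrunc u : ArithmeticFunction ℝ)) := by
  have h : (μ : ArithmeticFunction ℝ) * (ζ : ArithmeticFunction ℝ) = 1 := coe_moebius_mul_coe_zeta
  rw [gU]
  linear_combination (2 * (Literature.NumberTheory.Sieve.moebiusTrunc u : ArithmeticFunction ℝ) -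
    (μ : ArithmeticFunction ℝ)) * h

/-- `(μ − μ_u)(ℓ) = μ(ℓ)` for `ℓ > u` and `0` otherwise. [folklore] -/
theorem moebius_sub_trunc_apply (u ℓ : ℕ) :
    ((μ : ArithmeticFunction ℝ) -
        (Literature.NumberTheory.Sieve.moebiusTrunc u : ArithmeticFunction ℝ)) ℓ =
      if ℓ ≤ u then 0 else (μ ℓ : ℝ) := by
  rw [arith_sub_apply, intCoe_apply, intCoe_apply, Literature.NumberTheory.Sieve.moebiusTrunc_apply]
  split_ifs <;> simp

/-- `|(μ − μ_u)(ℓ)| ≤ 1`. [folklore] -/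
theorem abs_moebius_sub_trunc_le (u ℓ : ℕ) :
    |((μ : ArithmeticFunction ℝ) -
        (Literature.NumberTheory.Sieve.moebiusTrunc u : ArithmeticFunction ℝ)) ℓ| ≤ 1 := by
  rw [moebius_sub_trunc_apply]
  split_ifs
  · simp
  · exact_mod_cast abs_moebius_le_one

/-- `|(μ_u * μ_u)(k)| ≤ τ(k)`. [folklore] -/
theorem abs_trunc_mul_trunc_le (u k : ℕ) :
    |((Literature.NumberTheory.Sieve.moebiusTrunc u : ArithmeticFunction ℝ) *
        (Literature.NumberTheory.Sieve.moebiusTrunc u : ArithmeticFunction ℝ)) k| ≤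
      (#k.divisors : ℝ) := by
  rw [mul_apply, card_divisors_eq_sum_antidiagonal]
  refine (abs_sum_le_sum_abs _ _).trans (sum_le_sum fun x _ => ?_)
  rw [abs_mul]
  have h1 := Literature.NumberTheory.Sieve.Vaughan.abs_moebiusTrunc_le_one u x.1
  have h2 := Literature.NumberTheory.Sieve.Vaughan.abs_moebiusTrunc_le_one u x.2
  rw [intCoe_apply, intCoe_apply]
  calc _ ≤ (1 : ℝ) * 1 := mul_le_mul h1 h2 (abs_nonneg _) zero_le_one
    _ = 1 := one_mul _

/-- `(μ_u * μ_u)(k) = 0` for `k > u²`. [folklore] -/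
theorem trunc_mul_trunc_eq_zero_of_lt {u k : ℕ} (hk : u * u < k) :
    ((Literature.NumberTheory.Sieve.moebiusTrunc u : ArithmeticFunction ℝ) *
        (Literature.NumberTheory.Sieve.moebiusTrunc u : ArithmeticFunction ℝ)) k = 0 := by
  rw [mul_apply]
  refine sum_eq_zero fun x hx => ?_
  rw [Nat.mem_divisorsAntidiagonal] at hx
  rw [intCoe_apply, intCoe_apply, Literature.NumberTheory.Sieve.moebiusTrunc_apply,
    Literature.NumberTheory.Sieve.moebiusTrunc_apply]
  by_cases h1 : x.1 ≤ u
  · by_cases h2 : x.2 ≤ u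
    · exfalso
      have : x.1 * x.2 ≤ u * u := Nat.mul_le_mul h1 h2
      omega
    · simp [h2]
  · simp [h1]

/-! ### The type I sum with divisor-bounded coefficients -/

/-- `∑_{k ≤ U} τ(k)²/k ≤ (1 + log U)⁴` (from `τ(ab) ≤ τ(a)τ(b)` and
`∑_{a ≤ U} τ(a)/a ≤ (1 + log U)²`). [folklore] -/
theorem sum_sq_card_divisors_div_le (U : ℕ) :
    ∑ k ∈ Ioc 0 U, ((#k.divisors : ℕ) : ℝ) ^ 2 / k ≤ (1 + Real.log U) ^ 4 := by
  have hlog : 0 ≤ 1 + Real.log U := by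
    rcases Nat.eq_zero_or_pos U with rfl | hU
    · simp
    · have := Real.log_nonneg (show (1 : ℝ) ≤ U by exact_mod_cast hU); linarith
  have h1 : ∀ k ∈ Ioc 0 U, ((#k.divisors : ℕ) : ℝ) ^ 2 / k ≤
      ∑ x ∈ k.divisorsAntidiagonal, ((#x.1.divisors : ℝ) / x.1) * ((#x.2.divisors : ℝ) / x.2) := by
    intro k hk
    have hk0 : (0 : ℝ) < k := by exact_mod_cast (mem_Ioc.mp hk).1
    have e1 := card_divisors_eq_sum_antidiagonal k
    have hsq : ((#k.divisors : ℕ) : ℝ) ^ 2 ≤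
        ∑ x ∈ k.divisorsAntidiagonal, (#x.1.divisors : ℝ) * #x.2.divisors := by
      calc ((#k.divisors : ℕ) : ℝ) ^ 2 = (∑ x ∈ k.divisorsAntidiagonal, (1 : ℝ)) * #k.divisors := by
            rw [← e1, sq]
        _ = ∑ x ∈ k.divisorsAntidiagonal, (#k.divisors : ℝ) := by rw [sum_mul]; simp
        _ ≤ ∑ x ∈ k.divisorsAntidiagonal, (#x.1.divisors : ℝ) * #x.2.divisors := by
            refine sum_le_sum fun x hx => ?_
            rw [Nat.mem_divisorsAntidiagonal] at hx
            rw [← hx.1]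
            exact_mod_cast card_divisors_mul_le x.1 x.2
    calc ((#k.divisors : ℕ) : ℝ) ^ 2 / k
        ≤ (∑ x ∈ k.divisorsAntidiagonal, (#x.1.divisors : ℝ) * #x.2.divisors) / k :=
          div_le_div_of_nonneg_right hsq hk0.le
      _ = ∑ x ∈ k.divisorsAntidiagonal, ((#x.1.divisors : ℝ) / x.1) * ((#x.2.divisors : ℝ) / x.2) := by
          rw [sum_div]
          refine sum_congr rfl fun x hx => ?_
          rw [Nat.mem_divisorsAntidiagonal] at hx
          rw [← hx.1, Nat.cast_mul]
          have h1 : (x.1 : ℝ) ≠ 0 := by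
            have : x.1 ≠ 0 := by intro h; rw [h, zero_mul] at hx; exact hx.2 hx.1.symm
            exact_mod_cast this
          have h2 : (x.2 : ℝ) ≠ 0 := by
            have : x.2 ≠ 0 := by intro h; rw [h, mul_zero] at hx; exact hx.2 hx.1.symm
            exact_mod_cast this
          field_simp
  refine (sum_le_sum h1).trans ?_
  rw [sum_Ioc_sum_divisorsAntidiagonal_eq
    (fun a b => ((#a.divisors : ℝ) / a) * ((#b.divisors : ℝ) / b)) U]
  calc ∑ a ∈ Ioc 0 U, ∑ b ∈ Ioc 0 (U / a), ((#a.divisors : ℝ) / a) * ((#b.divisors : ℝ) / b)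
      ≤ ∑ a ∈ Ioc 0 U, ((#a.divisors : ℝ) / a) * (1 + Real.log U) ^ 2 := by
        refine sum_le_sum fun a _ => ?_
        rw [← mul_sum]
        refine mul_le_mul_of_nonneg_left ?_ (by positivity)
        refine le_trans (sum_le_sum_of_subset_of_nonneg (Ioc_subset_Ioc_right (Nat.div_le_self U a))
          fun _ _ _ => by positivity) (sum_card_divisors_div_le U)
    _ ≤ (1 + Real.log U) ^ 2 * (1 + Real.log U) ^ 2 := by
        rw [← sum_mul]
        exact mul_le_mul_of_nonneg_right (sum_card_divisors_div_le U) (by positivity)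
    _ = (1 + Real.log U) ^ 4 := by ring

/-- **Type I sums with divisor-bounded coefficients**: if `|α − a/q| ≤ q⁻²`, `(a, q) = 1`,
`q ≥ 1`, `|c(k)| ≤ τ(k)` and `c(k) = 0` for `k > U` (`U ≥ 1`), then
`‖∑_{k ≤ N} c(k) ∑_{m ≤ N/k} e(αkm)‖ ≤ 2 (1 + log U)² √N √((N/q + U + q)(1 + log qU))`
(geometric sums `≤ min(N/k, 1/(2‖αk‖))`, Cauchy–Schwarz with `∑ τ(k)²/k ≤ (1 + log U)⁴`, and
Nathanson's Lemma 4.10 `sum_geomBound_div_le`). [cite: Nathanson1996, §4.4 Lemma 4.10 and §8.5] -/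
theorem norm_typeI_le {α : ℝ} {a : ℤ} {q : ℕ} (hq : 1 ≤ q) (hcop : IsCoprime a q)
    (hα : |α - a / q| ≤ 1 / (q : ℝ) ^ 2) {N U : ℕ} (hU : 1 ≤ U) {c : ℕ → ℝ}
    (hc : ∀ k, |c k| ≤ (#k.divisors : ℝ)) (hc0 : ∀ k, U < k → c k = 0) :
    ‖∑ k ∈ Icc 1 N, (c k : ℂ) * ∑ m ∈ Icc 1 (N / k), (𝐞 ((m : ℝ) * (α * k)) : ℂ)‖ ≤
      2 * (1 + Real.log U) ^ 2 * Real.sqrt N *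
        Real.sqrt ((N / q + U + q) * (1 + Real.log (q * U))) := by
  have hN0 : (0 : ℝ) ≤ N := Nat.cast_nonneg N
  set G : ℕ → ℝ := fun k => geomBound ((N : ℝ) / k) (α * k) with hGdef
  have hG0 : ∀ k, 0 ≤ G k := fun k => geomBound_nonneg (by positivity) _
  -- termwise: `‖c(k) ∑ e‖ ≤ 1_{k ≤ U} τ(k) G(k)`
  have hterm : ∀ k ∈ Icc 1 N,
      ‖(c k : ℂ) * ∑ m ∈ Icc 1 (N / k), (𝐞 ((m : ℝ) * (α * k)) : ℂ)‖ ≤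
        if k ≤ U then (#k.divisors : ℝ) * G k else 0 := by
    intro k hk
    rw [norm_mul, Complex.norm_real, Real.norm_eq_abs]
    split_ifs with hkU
    · exact mul_le_mul (hc k) (norm_sum_Icc_fourierChar_le_geomBound _ Nat.cast_div_le)
        (norm_nonneg _) (by positivity)
    · rw [hc0 k (not_le.mp hkU)]; simp
  refine (norm_sum_le _ _).trans ((sum_le_sum hterm).trans ?_)
  rw [← sum_filter]
  have hsub : (Icc 1 N).filter (fun k => k ≤ U) ⊆ Ioc 0 U := by
    intro k hk
    simp only [mem_filter, mem_Icc, mem_Ioc] at hk ⊢; omega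
  refine (sum_le_sum_of_subset_of_nonneg hsub fun k _ _ => by
    exact mul_nonneg (Nat.cast_nonneg _) (hG0 k)).trans ?_
  -- Cauchy–Schwarz with `f = τ(k)/√k`, `g = √k G(k)`
  have hIoc : Ioc 0 U = Icc 1 U := by ext k; simp only [mem_Ioc, mem_Icc]; omega
  have hsplit : ∀ k ∈ Ioc 0 U, (#k.divisors : ℝ) * G k =
      ((#k.divisors : ℝ) / Real.sqrt k) * (Real.sqrt k * G k) := by
    intro k hk
    have hk0 : (0 : ℝ) < k := by exact_mod_cast (mem_Ioc.mp hk).1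
    have hs : Real.sqrt k ≠ 0 := (Real.sqrt_pos.2 hk0).ne'
    field_simp
  rw [sum_congr rfl hsplit]
  have hCS := sum_mul_sq_le_sq_mul_sq (Ioc 0 U) (fun k => (#k.divisors : ℝ) / Real.sqrt k)
    (fun k => Real.sqrt k * G k)
  have hA : ∑ k ∈ Ioc 0 U, ((#k.divisors : ℝ) / Real.sqrt k) ^ 2 ≤ (1 + Real.log U) ^ 4 := by
    refine le_trans (le_of_eq (sum_congr rfl fun k hk => ?_)) (sum_sq_card_divisors_div_le U)
    have hk0 : (0 : ℝ) < k := by exact_mod_cast (mem_Ioc.mp hk).1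
    rw [div_pow, Real.sq_sqrt hk0.le]
  have hB : ∑ k ∈ Ioc 0 U, (Real.sqrt k * G k) ^ 2 ≤
      N * (4 * (N / q + U + q) * (1 + Real.log (q * U))) := by
    have h1 : ∀ k ∈ Ioc 0 U, (Real.sqrt k * G k) ^ 2 ≤ N * G k := by
      intro k hk
      have hk0 : (0 : ℝ) < k := by exact_mod_cast (mem_Ioc.mp hk).1
      have hGk : G k ≤ N / k := geomBound_le _ _
      rw [mul_pow, Real.sq_sqrt hk0.le, sq]
      calc (k : ℝ) * (G k * G k) = (k * G k) * G k := by ring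
        _ ≤ (k * (N / k)) * G k :=
            mul_le_mul_of_nonneg_right (mul_le_mul_of_nonneg_left hGk hk0.le) (hG0 k)
        _ = N * G k := by field_simp
    refine (sum_le_sum h1).trans ?_
    rw [← mul_sum, hIoc]
    exact mul_le_mul_of_nonneg_left (sum_geomBound_div_le hq hcop hα hN0 hU) hN0
  have hS0 : 0 ≤ ∑ k ∈ Ioc 0 U, ((#k.divisors : ℝ) / Real.sqrt k) * (Real.sqrt k * G k) :=
    sum_nonneg fun k _ => mul_nonneg (by positivity) (mul_nonneg (Real.sqrt_nonneg _) (hG0 k))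
  have hX0 : 0 ≤ (N / q + U + q) * (1 + Real.log (q * U)) := by
    have hqU : (1 : ℝ) ≤ q * U := by
      have h1 : (1 : ℝ) ≤ q := by exact_mod_cast hq
      have h2 : (1 : ℝ) ≤ U := by exact_mod_cast hU
      nlinarith
    have := Real.log_nonneg hqU
    positivity
  calc ∑ k ∈ Ioc 0 U, ((#k.divisors : ℝ) / Real.sqrt k) * (Real.sqrt k * G k)
      = Real.sqrt ((∑ k ∈ Ioc 0 U, ((#k.divisors : ℝ) / Real.sqrt k) * (Real.sqrt k * G k)) ^ 2) :=
        (Real.sqrt_sq hS0).symm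
    _ ≤ Real.sqrt ((1 + Real.log U) ^ 4 * (N * (4 * (N / q + U + q) * (1 + Real.log (q * U))))) := by
        refine Real.sqrt_le_sqrt (hCS.trans ?_)
        exact mul_le_mul hA hB (sum_nonneg fun _ _ => sq_nonneg _) (by positivity)
    _ = 2 * (1 + Real.log U) ^ 2 * Real.sqrt N *
        Real.sqrt ((N / q + U + q) * (1 + Real.log (q * U))) := by
        have e : (1 + Real.log U) ^ 4 * (N * (4 * (N / q + U + q) * (1 + Real.log (q * U)))) =
            (2 * (1 + Real.log U) ^ 2) ^ 2 * (N * ((N / q + U + q) * (1 + Real.log (q * U)))) := by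
          ring
        have hlog : 0 ≤ 1 + Real.log U := by
          have := Real.log_nonneg (show (1 : ℝ) ≤ U by exact_mod_cast hU); linarith
        rw [e, Real.sqrt_mul (by positivity), Real.sqrt_sq (by positivity),
          Real.sqrt_mul hN0]
        ring

/-! ### The type II sum (Nathanson's Lemma 8.8 with `Λ − Λ_u` replaced by `μ − μ_u`) -/

open Literature.NumberTheory.Sieve (moebiusTrunc)

/-- **Cauchy–Schwarz on a dyadic block** for the Möbius type II sum:
`‖∑_{K<k≤2K} G_u(k) T(k)‖ ≤ (2K(1+log 2K)³)^{1/2} ((2 log N)² (N + 8(N/K)(N/q+N/K+q)(1+log qN)))^{1/2}`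
with `T(k) = ∑_{ℓ ≤ N/k} (μ − μ_u)(ℓ) e(αkℓ)` (`|μ − μ_u| ≤ 1 ≤ 2 log N` for `N ≥ 2`), from
`|G_u| ≤ τ`, `∑ τ² ≤ x(1 + log x)³` and the tree's mean square `typeII_sum_norm_sq_le`.
[cite: Nathanson1996, §8.5, proof of Lemma 8.8] -/
theorem norm_typeII_block_le_sqrt {α : ℝ} {a : ℤ} {q : ℕ} (hq : 1 ≤ q) (hcop : IsCoprime a q)
    (hα : |α - a / q| ≤ 1 / (q : ℝ) ^ 2) {N K : ℕ} (hN : 2 ≤ N) (hK : 1 ≤ K) (u : ℕ) :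
    ‖∑ k ∈ Ioc K (2 * K), (gU u k : ℂ) *
        ∑ ℓ ∈ Icc 1 (N / k), ((((μ : ArithmeticFunction ℝ) -
          (moebiusTrunc u : ArithmeticFunction ℝ)) ℓ : ℝ) : ℂ) * (𝐞 ((ℓ : ℝ) * (α * k)) : ℂ)‖ ≤
      Real.sqrt (2 * K * (1 + Real.log (2 * K : ℕ)) ^ 3) *
        Real.sqrt ((2 * Real.log N) ^ 2 *
          (N + 8 * ((N : ℝ) / K) * (N / q + N / K + q) * (1 + Real.log (q * N)))) := by
  set G : ℕ → ℝ := fun k => gU u k with hGdef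
  set c : ℕ → ℝ := fun ℓ => ((μ : ArithmeticFunction ℝ) -
    (moebiusTrunc u : ArithmeticFunction ℝ)) ℓ with hcdef
  set T : ℕ → ℂ := fun k => ∑ ℓ ∈ Icc 1 (N / k), (c ℓ : ℂ) * (𝐞 ((ℓ : ℝ) * (α * k)) : ℂ)
    with hTdef
  show ‖∑ k ∈ Ioc K (2 * K), (G k : ℂ) * T k‖ ≤ _
  have h1 : ‖∑ k ∈ Ioc K (2 * K), (G k : ℂ) * T k‖ ≤ ∑ k ∈ Ioc K (2 * K), |G k| * ‖T k‖ := by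
    refine (norm_sum_le _ _).trans (le_of_eq (Finset.sum_congr rfl fun k _ => ?_))
    rw [norm_mul, Complex.norm_real, Real.norm_eq_abs]
  have hCS := Finset.sum_mul_sq_le_sq_mul_sq (Ioc K (2 * K)) (fun k => |G k|) (fun k => ‖T k‖)
  have hA : ∑ k ∈ Ioc K (2 * K), |G k| ^ 2 ≤ 2 * K * (1 + Real.log (2 * K : ℕ)) ^ 3 := by
    calc ∑ k ∈ Ioc K (2 * K), |G k| ^ 2
        ≤ ∑ k ∈ Ioc K (2 * K), ((k.divisors.card : ℕ) : ℝ) ^ 2 := by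
          refine Finset.sum_le_sum fun k _ => pow_le_pow_left₀ (abs_nonneg _) ?_ 2
          have h := abs_gU_le u k
          rw [ArithmeticFunction.sigma_zero_apply] at h
          exact h
      _ ≤ ∑ k ∈ Ioc 0 (2 * K), ((k.divisors.card : ℕ) : ℝ) ^ 2 :=
          Finset.sum_le_sum_of_subset_of_nonneg (Finset.Ioc_subset_Ioc_left (Nat.zero_le K))
            fun _ _ _ => sq_nonneg _
      _ ≤ ((2 * K : ℕ) : ℝ) * (1 + Real.log (2 * K : ℕ)) ^ 3 := sum_sq_card_divisors_le (2 * K)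
      _ = 2 * K * (1 + Real.log (2 * K : ℕ)) ^ 3 := by push_cast; ring
  have hlog2 : (1 : ℝ) ≤ 2 * Real.log N := by
    have := half_lt_log hN; linarith
  have hB : ∑ k ∈ Ioc K (2 * K), ‖T k‖ ^ 2 ≤ (2 * Real.log N) ^ 2 *
      (N + 8 * ((N : ℝ) / K) * (N / q + N / K + q) * (1 + Real.log (q * N))) := by
    refine typeII_sum_norm_sq_le hq hcop hα hK (by linarith) fun ℓ _ => ?_
    exact (abs_moebius_sub_trunc_le u ℓ).trans hlog2
  have hS0 : 0 ≤ ∑ k ∈ Ioc K (2 * K), |G k| * ‖T k‖ :=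
    Finset.sum_nonneg fun k _ => mul_nonneg (abs_nonneg _) (norm_nonneg _)
  calc ‖∑ k ∈ Ioc K (2 * K), (G k : ℂ) * T k‖ ≤ ∑ k ∈ Ioc K (2 * K), |G k| * ‖T k‖ := h1
    _ = Real.sqrt ((∑ k ∈ Ioc K (2 * K), |G k| * ‖T k‖) ^ 2) := (Real.sqrt_sq hS0).symm
    _ ≤ Real.sqrt ((∑ k ∈ Ioc K (2 * K), |G k| ^ 2) * ∑ k ∈ Ioc K (2 * K), ‖T k‖ ^ 2) :=
        Real.sqrt_le_sqrt hCS
    _ ≤ Real.sqrt ((2 * K * (1 + Real.log (2 * K : ℕ)) ^ 3) * ((2 * Real.log N) ^ 2 *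
          (N + 8 * ((N : ℝ) / K) * (N / q + N / K + q) * (1 + Real.log (q * N))))) := by
        refine Real.sqrt_le_sqrt (mul_le_mul hA hB (Finset.sum_nonneg fun _ _ => sq_nonneg _) ?_)
        positivity
    _ = _ := Real.sqrt_mul (by positivity) _

/-- **The type II sum on a dyadic block** for `μ`: for `|α − a/q| ≤ q⁻²`, `(a, q) = 1`,
`1 ≤ q ≤ N`, `2 ≤ N`, `1 ≤ u ≤ K`, `Ku ≤ N`:
`‖∑_{K<k≤2K} G_u(k) ∑_{ℓ ≤ N/k} (μ−μ_u)(ℓ) e(αkℓ)‖ ≤ 128 (log N)³ (N/√q + 2N/√u + √N√q)`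
(the tree's `typeII_block_core` with the extra factor `4 = 2²` from `|μ − μ_u| ≤ 2 log N`).
[cite: Nathanson1996, §8.5, proof of Lemma 8.8] -/
theorem norm_typeII_block_le {α : ℝ} {a : ℤ} {q : ℕ} (hq : 1 ≤ q) (hcop : IsCoprime a q)
    (hα : |α - a / q| ≤ 1 / (q : ℝ) ^ 2) {N K u : ℕ} (hN : 2 ≤ N) (hqN : q ≤ N) (hu : 1 ≤ u)
    (huK : u ≤ K) (hKu : K * u ≤ N) :
    ‖∑ k ∈ Ioc K (2 * K), (gU u k : ℂ) *
        ∑ ℓ ∈ Icc 1 (N / k), ((((μ : ArithmeticFunction ℝ) -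
          (moebiusTrunc u : ArithmeticFunction ℝ)) ℓ : ℝ) : ℂ) * (𝐞 ((ℓ : ℝ) * (α * k)) : ℂ)‖ ≤
      128 * Real.log N ^ 3 *
        (N / Real.sqrt q + 2 * (N / Real.sqrt u) + Real.sqrt N * Real.sqrt q) := by
  have hK : 1 ≤ K := le_trans hu huK
  refine (norm_typeII_block_le_sqrt hq hcop hα hN hK u).trans ?_
  have hL2 : 1 / 2 < Real.log N := half_lt_log hN
  have hlogN2 : Real.log 2 ≤ Real.log N := Real.log_le_log (by norm_num) (by exact_mod_cast hN)
  have hlog2' := Real.log_two_gt_d9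
  have hN0 : (0 : ℝ) < N := by exact_mod_cast (lt_of_lt_of_le (by norm_num) hN)
  have hN1 : (1 : ℝ) ≤ N := by exact_mod_cast (le_trans (by norm_num) hN)
  have hq0 : (0 : ℝ) < q := by exact_mod_cast hq
  have hq1 : (1 : ℝ) ≤ q := by exact_mod_cast hq
  have hK0 : (0 : ℝ) < K := by exact_mod_cast hK
  have hu0 : (0 : ℝ) < u := by exact_mod_cast hu
  have hKN : (K : ℝ) ≤ N / u := by
    rw [le_div_iff₀ hu0]; exact_mod_cast hKu
  have huK' : (u : ℝ) ≤ K := by exact_mod_cast huK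
  have hlog2K : 1 + Real.log (2 * K : ℕ) ≤ 4 * Real.log N := by
    have hKN' : (K : ℝ) ≤ N := le_trans hKN (div_le_self hN0.le (by exact_mod_cast hu))
    have h1 : Real.log (2 * K : ℕ) ≤ Real.log 2 + Real.log N := by
      rw [← Real.log_mul (by norm_num) hN0.ne']
      exact Real.log_le_log (by positivity) (by push_cast; linarith)
    linarith
  have hlog2K0 : 0 ≤ 1 + Real.log (2 * K : ℕ) := by
    have := Real.log_natCast_nonneg (2 * K); linarith
  have hlogqN : 1 + Real.log (q * N) ≤ 4 * Real.log N := by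
    have h1 : Real.log (q * N) ≤ Real.log N + Real.log N := by
      rw [← Real.log_mul hN0.ne' hN0.ne']
      exact Real.log_le_log (by positivity)
        (mul_le_mul_of_nonneg_right (by exact_mod_cast hqN) hN0.le)
    linarith
  have hlogqN0 : 0 ≤ 1 + Real.log (q * N) := by
    have := Real.log_nonneg (one_le_mul_of_one_le_of_one_le hq1 hN1); linarith
  have hP2 : ((N : ℝ) / Real.sqrt q) ^ 2 = (N : ℝ) ^ 2 / q := by
    rw [div_pow, Real.sq_sqrt hq0.le]
  have hQ2 : ((N : ℝ) / Real.sqrt u) ^ 2 = (N : ℝ) ^ 2 / u := by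
    rw [div_pow, Real.sq_sqrt hu0.le]
  have hR2 : (Real.sqrt N * Real.sqrt q) ^ 2 = (N : ℝ) * q := by
    rw [mul_pow, Real.sq_sqrt hN0.le, Real.sq_sqrt hq0.le]
  have hcore := typeII_block_core hL2 hK0 hN0 hq0 hu0 hKN huK' hlog2K0 hlog2K hlogqN0 hlogqN
    (by positivity) (by positivity) (by positivity) hP2 hQ2 hR2
  have hD0 : 0 ≤ 128 * Real.log N ^ 3 *
      (N / Real.sqrt q + 2 * (N / Real.sqrt u) + Real.sqrt N * Real.sqrt q) := by positivity
  rw [← Real.sqrt_mul (by positivity), ← Real.sqrt_sq hD0]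
  refine Real.sqrt_le_sqrt ?_
  have e1 : 2 * (K : ℝ) * (1 + Real.log (2 * K : ℕ)) ^ 3 * ((2 * Real.log N) ^ 2 *
      (N + 8 * ((N : ℝ) / K) * (N / q + N / K + q) * (1 + Real.log (q * N)))) =
      4 * (2 * K * (1 + Real.log (2 * K : ℕ)) ^ 3 * (Real.log N ^ 2 *
        (N + 8 * ((N : ℝ) / K) * (N / q + N / K + q) * (1 + Real.log (q * N))))) := by ring
  have e2 : (128 * Real.log N ^ 3 *
      (N / Real.sqrt q + 2 * (N / Real.sqrt u) + Real.sqrt N * Real.sqrt q)) ^ 2 =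
      4 * (64 * Real.log N ^ 3 *
        (N / Real.sqrt q + 2 * (N / Real.sqrt u) + Real.sqrt N * Real.sqrt q)) ^ 2 := by ring
  rw [e1, e2]
  exact mul_le_mul_of_nonneg_left hcore (by norm_num)

/-- **The Möbius type II sum** (Nathanson's Lemma 8.8 for `μ`): for `|α − a/q| ≤ q⁻²`,
`(a, q) = 1`, `1 ≤ q ≤ N`, `2 ≤ N`, `1 ≤ u`,
`‖∑_{k ≤ N} G_u(k) ∑_{ℓ ≤ N/k} (μ − μ_u)(ℓ) e(αkℓ)‖ ≤ 512 (log N)⁴ (N/√q + 2N/√u + √N√q)`: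
dyadic blocks `(u2^i, u2^{i+1}]`, `i ≤ log₂ N`, each bounded by `norm_typeII_block_le`
(blocks with `u2^i > N/u` vanish since `μ − μ_u = 0` on `[1, u]`).
[cite: Nathanson1996, §8.5, Lemma 8.8; Green2012, §4 Proposition 4] -/
theorem norm_typeII_le {α : ℝ} {a : ℤ} {q : ℕ} (hq : 1 ≤ q) (hcop : IsCoprime a q)
    (hα : |α - a / q| ≤ 1 / (q : ℝ) ^ 2) {N u : ℕ} (hN : 2 ≤ N) (hqN : q ≤ N) (hu : 1 ≤ u) :
    ‖afExpSum (⇑(gU u * ((μ : ArithmeticFunction ℝ) -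
        (moebiusTrunc u : ArithmeticFunction ℝ)))) N α‖ ≤
      512 * Real.log N ^ 4 *
        (N / Real.sqrt q + 2 * (N / Real.sqrt u) + Real.sqrt N * Real.sqrt q) := by
  rw [afExpSum_mul]
  set h := Nat.log 2 N + 1 with hh
  have hN0 : N ≠ 0 := by omega
  have hNh : N ≤ u * 2 ^ h := by
    have h1 : N < 2 ^ h := Nat.lt_pow_succ_log_self (by norm_num) N
    have h2 : 2 ^ h ≤ u * 2 ^ h := Nat.le_mul_of_pos_left _ hu
    omega
  set D : ℝ := 128 * Real.log N ^ 3 *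
    (N / Real.sqrt q + 2 * (N / Real.sqrt u) + Real.sqrt N * Real.sqrt q) with hD
  have hlogN : 0 ≤ Real.log N := Real.log_natCast_nonneg N
  have hD0 : 0 ≤ D := by positivity
  rw [sum_Icc_eq_sum_dyadic hNh _ ?hf0 ?hfN]
  case hf0 =>
    intro k hk
    rw [gU_eq_zero_of_le hk]; simp
  case hfN =>
    intro k hk
    have : N / k = 0 := Nat.div_eq_of_lt hk
    rw [this]; simp
  refine (norm_sum_le _ _).trans ?_
  have hblock : ∀ i ∈ range h,
      ‖∑ k ∈ Ioc (u * 2 ^ i) (u * 2 ^ i + u * 2 ^ i), (gU u k : ℂ) *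
          ∑ ℓ ∈ Icc 1 (N / k), ((((μ : ArithmeticFunction ℝ) -
            (moebiusTrunc u : ArithmeticFunction ℝ)) ℓ : ℝ) : ℂ) *
              (𝐞 ((ℓ : ℝ) * (α * k)) : ℂ)‖ ≤ D := by
    intro i _
    set K := u * 2 ^ i with hK
    rw [← two_mul K]
    have huK : u ≤ K := Nat.le_mul_of_pos_right u (Nat.two_pow_pos i)
    by_cases hKu : K * u ≤ N
    · exact norm_typeII_block_le hq hcop hα hN hqN hu huK hKu
    · rw [Finset.sum_eq_zero]
      · simpa using hD0
      intro k hk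
      have hKk : K < k := (Finset.mem_Ioc.mp hk).1
      have hk0 : 0 < k := by omega
      have hNk : N / k < u := by
        rw [Nat.div_lt_iff_lt_mul hk0]
        calc N < K * u := not_le.mp hKu
          _ ≤ u * k := by rw [mul_comm]; exact Nat.mul_le_mul_left u hKk.le
      have hT : ∑ ℓ ∈ Icc 1 (N / k), ((((μ : ArithmeticFunction ℝ) -
          (moebiusTrunc u : ArithmeticFunction ℝ)) ℓ : ℝ) : ℂ) *
            (𝐞 ((ℓ : ℝ) * (α * k)) : ℂ) = 0 := by
        refine Finset.sum_eq_zero fun ℓ hℓ => ?_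
        have hℓu : ℓ ≤ u := by have := (Finset.mem_Icc.mp hℓ).2; omega
        rw [moebius_sub_trunc_apply, if_pos hℓu]; simp
      rw [hT, mul_zero]
  refine (Finset.sum_le_sum hblock).trans ?_
  rw [Finset.sum_const, Finset.card_range, nsmul_eq_mul]
  -- `h ≤ 4 log N`
  have hL2 : 1 / 2 < Real.log N := half_lt_log hN
  have hlog2 := Real.log_two_gt_d9
  have hhL : (h : ℝ) ≤ 4 * Real.log N := by
    have h1 : ((Nat.log 2 N : ℕ) : ℝ) * Real.log 2 ≤ Real.log N := by
      rw [← Real.log_pow]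
      apply Real.log_le_log (by positivity)
      exact_mod_cast Nat.pow_log_le_self 2 hN0
    have h2 : ((Nat.log 2 N : ℕ) : ℝ) ≤ 2 * Real.log N := by
      by_contra hc
      have hc' := not_le.mp hc
      have : 2 * Real.log N * Real.log 2 < ((Nat.log 2 N : ℕ) : ℝ) * Real.log 2 :=
        mul_lt_mul_of_pos_right hc' (by linarith)
      nlinarith
    rw [hh]; push_cast; linarith
  calc (h : ℝ) * D ≤ 4 * Real.log N * D := mul_le_mul_of_nonneg_right hhL hD0
    _ = _ := by rw [hD]; ring

/-! ### Assembly -/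

/-- The Vaughan decomposition of `∑_{n ≤ N} μ(n) e(nα)` summed from `moebius_eq_three_terms`:
`S = T + T − S_I + S_II` with `T = ∑ μ_u(n)e(nα)`, `S_I = ∑ (μ_u * μ_u * ζ)(n) e(nα)`,
`S_II = ∑ (G_u * (μ − μ_u))(n) e(nα)`. [cite: Nathanson1996, §8.5, Lemma 8.5] -/
theorem afExpSum_moebius_eq_vaughan (u N : ℕ) (α : ℝ) :
    afExpSum (fun n => (μ n : ℝ)) N α =
      afExpSum (⇑(moebiusTrunc u : ArithmeticFunction ℝ)) N α +
      afExpSum (⇑(moebiusTrunc u : ArithmeticFunction ℝ)) N α -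
      afExpSum (⇑((moebiusTrunc u : ArithmeticFunction ℝ) * (moebiusTrunc u : ArithmeticFunction ℝ) *
        (ζ : ArithmeticFunction ℝ))) N α +
      afExpSum (⇑(gU u * ((μ : ArithmeticFunction ℝ) -
        (moebiusTrunc u : ArithmeticFunction ℝ)))) N α := by
  have hV := moebius_eq_three_terms u
  unfold afExpSum
  rw [← Finset.sum_add_distrib, ← Finset.sum_sub_distrib, ← Finset.sum_add_distrib]
  refine Finset.sum_congr rfl fun n _ => ?_
  have h := congrArg (fun F : ArithmeticFunction ℝ => F n) hV
  simp only [ArithmeticFunction.add_apply, arith_sub_apply] at h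
  rw [intCoe_apply (f := ArithmeticFunction.moebius)] at h
  show (((μ n : ℤ) : ℝ) : ℂ) * _ = _
  rw [h]
  push_cast
  ring

/-- `‖∑_{n ≤ N} μ_u(n) e(nα)‖ ≤ u`. [folklore] -/
theorem norm_afExpSum_moebiusTrunc_le (u N : ℕ) (α : ℝ) :
    ‖afExpSum (⇑(moebiusTrunc u : ArithmeticFunction ℝ)) N α‖ ≤ u := by
  refine (norm_afExpSum_le _ N α).trans ?_
  calc ∑ n ∈ Icc 1 N, |(moebiusTrunc u : ArithmeticFunction ℝ) n|
      ≤ ∑ n ∈ Icc 1 N, (if n ≤ u then (1 : ℝ) else 0) :=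
        Finset.sum_le_sum fun n _ => abs_moebiusTrunc_le u n
    _ = (((Icc 1 N).filter (fun n => n ≤ u)).card : ℝ) := by
        rw [Finset.sum_ite, Finset.sum_const_zero, add_zero, Finset.sum_const, nsmul_eq_mul, mul_one]
    _ ≤ ((Icc 1 u).card : ℝ) := by
        have hsub : (Icc 1 N).filter (fun n => n ≤ u) ⊆ Icc 1 u := by
          intro n hn; simp only [mem_filter, mem_Icc] at hn ⊢; omega
        exact_mod_cast Finset.card_le_card hsub
    _ = u := by simp

/-- The type I piece of the Möbius sum: `‖∑ (μ_u * μ_u * ζ)(n) e(nα)‖ ≤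
2 (1 + log u²)² √N √((N/q + u² + q)(1 + log(qu²)))`. [cite: Nathanson1996, §8.5, Lemma 8.7] -/
theorem norm_SI_le {α : ℝ} {a : ℤ} {q : ℕ} (hq : 1 ≤ q) (hcop : IsCoprime a q)
    (hα : |α - a / q| ≤ 1 / (q : ℝ) ^ 2) {u : ℕ} (hu : 1 ≤ u) (N : ℕ) :
    ‖afExpSum (⇑((moebiusTrunc u : ArithmeticFunction ℝ) *
        (moebiusTrunc u : ArithmeticFunction ℝ) * (ζ : ArithmeticFunction ℝ))) N α‖ ≤
      2 * (1 + Real.log (u * u : ℕ)) ^ 2 * Real.sqrt N *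
        Real.sqrt ((N / q + (u * u : ℕ) + q) * (1 + Real.log (q * (u * u : ℕ)))) := by
  rw [afExpSum_mul]
  have hin : ∀ k ∈ Icc 1 N, (((moebiusTrunc u : ArithmeticFunction ℝ) *
      (moebiusTrunc u : ArithmeticFunction ℝ)) k : ℂ) *
        ∑ m ∈ Icc 1 (N / k), ((ζ : ArithmeticFunction ℝ) m : ℂ) * (𝐞 ((m : ℝ) * (α * k)) : ℂ) =
      (((moebiusTrunc u : ArithmeticFunction ℝ) *
        (moebiusTrunc u : ArithmeticFunction ℝ)) k : ℂ) *
          ∑ m ∈ Icc 1 (N / k), (𝐞 ((m : ℝ) * (α * k)) : ℂ) := by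
    intro k _
    congr 1
    refine Finset.sum_congr rfl fun m hm => ?_
    have hm1 : m ≠ 0 := by have := (Finset.mem_Icc.mp hm).1; omega
    rw [ArithmeticFunction.natCoe_apply, ArithmeticFunction.zeta_apply_ne hm1]
    simp
  rw [Finset.sum_congr rfl hin]
  exact norm_typeI_le hq hcop hα (Nat.mul_le_mul hu hu) (fun k => abs_trunc_mul_trunc_le u k)
    fun k hk => trunc_mul_trunc_eq_zero_of_lt hk

/-- `√(N(N/q + U + q)) ≤ N/√q + √U √N + √N √q` (compare squares). [folklore] -/
theorem sqrt_mul_le_three {N q U : ℝ} (hN : 0 ≤ N) (hq : 0 < q) (hU : 0 ≤ U) :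
    Real.sqrt N * Real.sqrt (N / q + U + q) ≤
      N / Real.sqrt q + Real.sqrt U * Real.sqrt N + Real.sqrt N * Real.sqrt q := by
  rw [← Real.sqrt_mul hN, Real.sqrt_le_iff]
  have hsq0 : 0 < Real.sqrt q := Real.sqrt_pos.2 hq
  refine ⟨by positivity, ?_⟩
  have hP2 : (N / Real.sqrt q) ^ 2 = N ^ 2 / q := by rw [div_pow, Real.sq_sqrt hq.le]
  have hQ2 : (Real.sqrt U * Real.sqrt N) ^ 2 = U * N := by
    rw [mul_pow, Real.sq_sqrt hU, Real.sq_sqrt hN]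
  have hR2 : (Real.sqrt N * Real.sqrt q) ^ 2 = N * q := by
    rw [mul_pow, Real.sq_sqrt hN, Real.sq_sqrt hq.le]
  have hcross : 0 ≤ 2 * ((N / Real.sqrt q) * (Real.sqrt U * Real.sqrt N)) +
      2 * ((N / Real.sqrt q) * (Real.sqrt N * Real.sqrt q)) +
      2 * ((Real.sqrt U * Real.sqrt N) * (Real.sqrt N * Real.sqrt q)) := by positivity
  calc N * (N / q + U + q) = N ^ 2 / q + U * N + N * q := by ring
    _ = (N / Real.sqrt q) ^ 2 + (Real.sqrt U * Real.sqrt N) ^ 2 + (Real.sqrt N * Real.sqrt q) ^ 2 := by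
        rw [hP2, hQ2, hR2]
    _ ≤ _ := by nlinarith

/-- The real-variable bookkeeping of the final assembly. [folklore] -/
theorem assembly_core {L u M P R Q' W T₀ T₁ T₂ : ℝ} (hL2 : 1 / 2 < L) (hP : 0 ≤ P) (hR : 0 ≤ R)
    (hu0 : 0 ≤ u) (huM : u ≤ M) (hW : W ≤ M) (hQ' : Q' ≤ 2 * M)
    (h₀ : T₀ ≤ 2 * u) (h₁ : T₁ ≤ 96 * L ^ 3 * (P + W + R))
    (h₂ : T₂ ≤ 512 * L ^ 4 * (P + 2 * Q' + R)) :
    T₀ + T₁ + T₂ ≤ 4096 * L ^ 4 * (P + M + R) := by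
  have hL0 : 0 < L := by linarith
  have hM : 0 ≤ M := hu0.trans huM
  have h2L : 1 ≤ 2 * L := by linarith
  have hL4 : 1 ≤ 16 * L ^ 4 := by nlinarith [pow_le_pow_left₀ zero_le_one h2L 4]
  have hL34 : L ^ 3 ≤ 2 * L ^ 4 := by nlinarith [pow_pos hL0 3]
  have hX : 0 ≤ P + M + R := by positivity
  have e0 : T₀ ≤ 32 * L ^ 4 * (P + M + R) := by
    have : 2 * u ≤ 2 * (P + M + R) := by linarith
    nlinarith
  have e1 : T₁ ≤ 192 * L ^ 4 * (P + M + R) := by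
    have h3 : 96 * L ^ 3 * (P + W + R) ≤ 96 * L ^ 3 * (P + M + R) :=
      mul_le_mul_of_nonneg_left (by linarith) (by positivity)
    have h4 : 96 * L ^ 3 * (P + M + R) ≤ 96 * (2 * L ^ 4) * (P + M + R) :=
      mul_le_mul_of_nonneg_right (mul_le_mul_of_nonneg_left hL34 (by norm_num)) hX
    linarith
  have e2 : T₂ ≤ 2048 * L ^ 4 * (P + M + R) := by
    have h3 : 512 * L ^ 4 * (P + 2 * Q' + R) ≤ 512 * L ^ 4 * (4 * (P + M + R)) :=
      mul_le_mul_of_nonneg_left (by linarith) (by positivity)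
    linarith
  have : 0 ≤ L ^ 4 * (P + M + R) := by positivity
  linarith

/-- **Davenport–Vaughan bound with a parameter**: for `|α − a/q| ≤ q⁻²`, `(a, q) = 1`,
`1 ≤ q ≤ N`, `2 ≤ N` and `u = ⌊N^{2/5}⌋`,
`‖∑_{n ≤ N} μ(n) e(nα)‖ ≤ 4096 (log N)⁴ (N/√q + N^{9/10} + √N √q)`.
[cite: Nathanson1996, §8.5, Theorem 8.5 (adapted to `μ`); Green2012, §4 Proposition 4] -/
theorem norm_afExpSum_moebius_le {α : ℝ} {a : ℤ} {q : ℕ} (hq : 1 ≤ q) (hcop : IsCoprime a q)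
    (hα : |α - a / q| ≤ 1 / (q : ℝ) ^ 2) {N : ℕ} (hN : 2 ≤ N) (hqN : q ≤ N) :
    ‖afExpSum (fun n => (μ n : ℝ)) N α‖ ≤
      4096 * Real.log N ^ 4 * (N / Real.sqrt q + (N : ℝ) ^ (9 / 10 : ℝ) + Real.sqrt N * Real.sqrt q) := by
  obtain ⟨hu1, huN, _, hu3⟩ := floor_rpow_two_fifths_bounds (le_trans (by norm_num) hN)
  set u : ℕ := ⌊(N : ℝ) ^ (2 / 5 : ℝ)⌋₊ with hudef
  have hL2 : 1 / 2 < Real.log N := half_lt_log hN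
  have hlog2 := Real.log_two_gt_d9
  have hN0 : (0 : ℝ) < N := by exact_mod_cast (lt_of_lt_of_le (by norm_num) hN)
  have hN1 : (1 : ℝ) ≤ N := by exact_mod_cast (le_trans (by norm_num) hN)
  have hq0 : (0 : ℝ) < q := by exact_mod_cast hq
  have hq1 : (1 : ℝ) ≤ q := by exact_mod_cast hq
  have hu0 : (0 : ℝ) < u := by exact_mod_cast hu1
  have huN' : (u : ℝ) ≤ N := by exact_mod_cast huN
  have hqN' : (q : ℝ) ≤ N := by exact_mod_cast hqN
  set L : ℝ := Real.log N with hL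
  have hL0 : 0 < L := by linarith
  have hlogN2 : Real.log 2 ≤ L := Real.log_le_log (by norm_num) (by exact_mod_cast hN)
  -- the three pieces
  rw [afExpSum_moebius_eq_vaughan u N α]
  have hT := norm_afExpSum_moebiusTrunc_le u N α
  have hI := norm_SI_le hq hcop hα hu1 N
  have hII := norm_typeII_le hq hcop hα hN hqN hu1
  -- sizes of logarithms
  have huu : ((u * u : ℕ) : ℝ) = (u : ℝ) ^ 2 := by push_cast; ring
  have hlog_uu : 1 + Real.log ((u * u : ℕ) : ℝ) ≤ 4 * L := by
    have h1 : Real.log ((u * u : ℕ) : ℝ) ≤ L + L := by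
      rw [huu, sq, Real.log_mul hu0.ne' hu0.ne']
      have : Real.log u ≤ L := Real.log_le_log hu0 huN'
      linarith
    linarith
  have hlog_uu0 : 0 ≤ 1 + Real.log ((u * u : ℕ) : ℝ) := by
    have : (1 : ℝ) ≤ (u * u : ℕ) := by exact_mod_cast Nat.mul_le_mul hu1 hu1
    have := Real.log_nonneg this; linarith
  have hlog_quu : 1 + Real.log (q * ((u * u : ℕ) : ℝ)) ≤ (3 * L) ^ 2 := by
    have h1 : Real.log (q * ((u * u : ℕ) : ℝ)) ≤ L + L + L := by
      rw [← Real.log_mul hN0.ne' hN0.ne', ← Real.log_mul (by positivity) hN0.ne']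
      refine Real.log_le_log (by positivity) ?_
      push_cast
      have := mul_le_mul hqN' huN' hu0.le hN0.le
      calc (q : ℝ) * (u * u) = q * u * u := by ring
        _ ≤ N * N * N := mul_le_mul this huN' hu0.le (by positivity)
    -- `1 + 3L ≤ 9L²` since `L ≥ log 2 > 5/9`
    nlinarith
  have hlog_quu0 : 0 ≤ 1 + Real.log (q * ((u * u : ℕ) : ℝ)) := by
    have : (1 : ℝ) ≤ q * ((u * u : ℕ) : ℝ) := by
      have h2 : (1 : ℝ) ≤ (u * u : ℕ) := by exact_mod_cast Nat.mul_le_mul hu1 hu1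
      nlinarith
    have := Real.log_nonneg this; linarith
  -- geometric quantities
  set P : ℝ := N / Real.sqrt q with hPdef
  set R : ℝ := Real.sqrt N * Real.sqrt q with hRdef
  set W : ℝ := Real.sqrt ((u * u : ℕ) : ℝ) * Real.sqrt N with hWdef
  set M : ℝ := (N : ℝ) ^ (9 / 10 : ℝ) with hMdef
  have hP0 : 0 ≤ P := by positivity
  have hR0 : 0 ≤ R := by positivity
  -- type I in the shape `96 L³ (P + W + R)`
  have hI' : ‖afExpSum (⇑((moebiusTrunc u : ArithmeticFunction ℝ) *
      (moebiusTrunc u : ArithmeticFunction ℝ) * (ζ : ArithmeticFunction ℝ))) N α‖ ≤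
      96 * L ^ 3 * (P + W + R) := by
    refine hI.trans ?_
    have h1 : (1 + Real.log ((u * u : ℕ) : ℝ)) ^ 2 ≤ (4 * L) ^ 2 :=
      pow_le_pow_left₀ hlog_uu0 hlog_uu 2
    have h2 : Real.sqrt (((N : ℝ) / q + ((u * u : ℕ) : ℝ) + q) * (1 + Real.log (q * ((u * u : ℕ) : ℝ)))) ≤
        Real.sqrt ((N : ℝ) / q + ((u * u : ℕ) : ℝ) + q) * (3 * L) := by
      rw [Real.sqrt_mul (by positivity)]
      refine mul_le_mul_of_nonneg_left ?_ (Real.sqrt_nonneg _)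
      calc Real.sqrt (1 + Real.log (q * ((u * u : ℕ) : ℝ))) ≤ Real.sqrt ((3 * L) ^ 2) :=
            Real.sqrt_le_sqrt hlog_quu
        _ = 3 * L := Real.sqrt_sq (by positivity)
    have h3 : Real.sqrt N * Real.sqrt ((N : ℝ) / q + ((u * u : ℕ) : ℝ) + q) ≤ P + W + R :=
      sqrt_mul_le_three hN0.le hq0 (by positivity)
    have hs0 : 0 ≤ Real.sqrt ((N : ℝ) / q + ((u * u : ℕ) : ℝ) + q) := Real.sqrt_nonneg _
    calc 2 * (1 + Real.log ((u * u : ℕ) : ℝ)) ^ 2 * Real.sqrt N *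
          Real.sqrt (((N : ℝ) / q + ((u * u : ℕ) : ℝ) + q) * (1 + Real.log (q * ((u * u : ℕ) : ℝ))))
        ≤ 2 * (4 * L) ^ 2 * Real.sqrt N * (Real.sqrt ((N : ℝ) / q + ((u * u : ℕ) : ℝ) + q) * (3 * L)) := by
          gcongr
      _ = 96 * L ^ 3 * (Real.sqrt N * Real.sqrt ((N : ℝ) / q + ((u * u : ℕ) : ℝ) + q)) := by ring
      _ ≤ 96 * L ^ 3 * (P + W + R) := mul_le_mul_of_nonneg_left h3 (by positivity)
  -- `u ≤ M`, `W ≤ M`, `N/√u ≤ 2M`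
  have hx : (u : ℝ) ≤ (N : ℝ) ^ (2 / 5 : ℝ) := Nat.floor_le (Real.rpow_nonneg hN0.le _)
  have huM : (u : ℝ) ≤ M := by
    refine hx.trans ?_
    exact Real.rpow_le_rpow_of_exponent_le hN1 (by norm_num)
  have hWM : W ≤ M := by
    have h1 : Real.sqrt ((u * u : ℕ) : ℝ) = u := by
      rw [huu, Real.sqrt_sq hu0.le]
    rw [hWdef, h1, hMdef, Real.sqrt_eq_rpow]
    calc (u : ℝ) * (N : ℝ) ^ (1 / 2 : ℝ) ≤ (N : ℝ) ^ (2 / 5 : ℝ) * (N : ℝ) ^ (1 / 2 : ℝ) :=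
          mul_le_mul_of_nonneg_right hx (Real.rpow_nonneg hN0.le _)
      _ = (N : ℝ) ^ (9 / 10 : ℝ) := by rw [← Real.rpow_add hN0]; norm_num
  have hQ'M : (N : ℝ) / Real.sqrt u ≤ 2 * M := by
    refine hu3.trans ?_
    refine mul_le_mul_of_nonneg_left ?_ (by norm_num)
    exact Real.rpow_le_rpow_of_exponent_le hN1 (by norm_num)
  have hcore := assembly_core hL2 hP0 hR0 hu0.le huM hWM hQ'M
    (show ‖afExpSum (⇑(moebiusTrunc u : ArithmeticFunction ℝ)) N α‖ +
      ‖afExpSum (⇑(moebiusTrunc u : ArithmeticFunction ℝ)) N α‖ ≤ 2 * u by linarith)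
    hI' hII
  refine le_trans ?_ (hcore.trans (le_of_eq (by ring)))
  refine (norm_add_le _ _).trans (add_le_add ((norm_sub_le _ _).trans (add_le_add
    (norm_add_le _ _) le_rfl)) le_rfl)

/-! ### The inverse form (Green's Proposition 4) -/

/-- The trivial bound `‖∑_{n ≤ N} μ(n) e(nα)‖ ≤ N`. [folklore] -/
theorem norm_afExpSum_moebius_le_self (N : ℕ) (α : ℝ) :
    ‖afExpSum (fun n => (μ n : ℝ)) N α‖ ≤ N := by
  refine (norm_afExpSum_le _ N α).trans ?_
  calc ∑ n ∈ Icc 1 N, |((μ n : ℝ))| ≤ ∑ n ∈ Icc 1 N, (1 : ℝ) :=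
        Finset.sum_le_sum fun n _ => by exact_mod_cast ArithmeticFunction.abs_moebius_le_one
    _ = N := by simp

set_option maxHeartbeats 400000 in
/-- **Green 2012, Proposition 4** (inverse form of the minor-arc bound): there is an absolute
`C` such that for `N ≥ 2`, `δ > 0` and real `θ`, if `‖∑_{n ≤ N} μ(n) e(nθ)‖ ≥ δN` then there are
`q ≥ 1` and `a` with `q ≤ C((1 + log N)/δ)^{40}` and `|θ − a/q| ≤ C((1 + log N)/δ)^{40}/N`.
(Green: "there is some `q ≪ (log N/δ)^{16}` such that `|θ − a/q| ≪ (log N/δ)^{16} N^{-1}`"; the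
exponent is immaterial. Proof as printed: Dirichlet's theorem with `Q = N/W`, then
`norm_afExpSum_moebius_le` rules out `q > W`; tiny `δ` is trivial.)
[cite: Green2012, §4 Proposition 4] -/
theorem exists_rat_near_of_le_norm_afExpSum :
    ∃ C : ℝ, 0 < C ∧ ∀ N : ℕ, 2 ≤ N → ∀ (θ δ : ℝ), 0 < δ →
      δ * N ≤ ‖afExpSum (fun n => (μ n : ℝ)) N θ‖ →
        ∃ q : ℕ, ∃ a : ℤ, 1 ≤ q ∧ (q : ℝ) ≤ C * ((1 + Real.log N) / δ) ^ 40 ∧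
          |θ - a / q| ≤ C * ((1 + Real.log N) / δ) ^ 40 / N := by
  refine ⟨16384 ^ 10, by positivity, fun N hN θ δ hδ hS => ?_⟩
  have hN0 : (0 : ℝ) < N := by exact_mod_cast (lt_of_lt_of_le (by norm_num) hN)
  have hN1 : (1 : ℝ) ≤ N := by exact_mod_cast (le_trans (by norm_num) hN)
  set L : ℝ := Real.log N with hL
  have hL2 : 1 / 2 < L := half_lt_log hN
  have hL0 : 0 ≤ L := by linarith
  have hSN : ‖afExpSum (fun n => (μ n : ℝ)) N θ‖ ≤ N := norm_afExpSum_moebius_le_self N θ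
  have hδ1 : δ ≤ 1 := by
    by_contra h
    have : (N : ℝ) < δ * N := by nlinarith
    linarith
  set K : ℝ := (1 + L) / δ with hKdef
  have hK1 : 1 ≤ K := by
    rw [hKdef, le_div_iff₀ hδ]; linarith
  have hK0 : 0 < K := by linarith
  set B : ℝ := 16384 * (1 + L) ^ 4 / δ with hBdef
  have h1L4 : 1 ≤ (1 + L) ^ 4 := one_le_pow₀ (by linarith)
  have hB1 : 16384 ≤ B := by
    rw [hBdef, le_div_iff₀ hδ]; nlinarith
  have hB0 : 0 < B := by linarith
  have hBK : B ≤ 16384 * K ^ 4 := by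
    -- `(1+L)⁴/δ ≤ ((1+L)/δ)⁴` as `δ ≤ 1`
    rw [hBdef, hKdef, div_pow, div_le_iff₀ hδ]
    have hδ4 : δ ^ 4 ≤ δ := by
      calc δ ^ 4 ≤ δ ^ 1 := pow_le_pow_of_le_one hδ.le hδ1 (by norm_num)
        _ = δ := pow_one δ
    have hδ40 : 0 < δ ^ 4 := by positivity
    have : (1 + L) ^ 4 ≤ (1 + L) ^ 4 / δ ^ 4 * δ := by
      rw [div_mul_eq_mul_div, le_div_iff₀ hδ40]
      exact mul_le_mul_of_nonneg_left hδ4 (by positivity)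
    calc 16384 * (1 + L) ^ 4 ≤ 16384 * ((1 + L) ^ 4 / δ ^ 4 * δ) := by linarith
      _ = 16384 * ((1 + L) ^ 4 / δ ^ 4) * δ := by ring
  have hCK : (16384 : ℝ) ^ 10 * K ^ 40 = (16384 * K ^ 4) ^ 10 := by ring
  have hB10 : B ^ 10 ≤ (16384 : ℝ) ^ 10 * K ^ 40 := by
    rw [hCK]; exact pow_le_pow_left₀ hB0.le hBK 10
  have hCK1 : (1 : ℝ) ≤ (16384 : ℝ) ^ 10 * K ^ 40 := by
    have : (1 : ℝ) ≤ K ^ 40 := one_le_pow₀ hK1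
    nlinarith
  -- the trivial output `q = 1`
  have htriv : (N : ℝ) ≤ B ^ 10 → ∃ q : ℕ, ∃ a : ℤ, 1 ≤ q ∧
      (q : ℝ) ≤ 16384 ^ 10 * ((1 + Real.log N) / δ) ^ 40 ∧
        |θ - a / q| ≤ 16384 ^ 10 * ((1 + Real.log N) / δ) ^ 40 / N := by
    intro hNB
    refine ⟨1, ⌊θ⌋, le_rfl, ?_, ?_⟩
    · simpa using hCK1
    · rw [Nat.cast_one, div_one, le_div_iff₀ hN0]
      have h1 : |θ - (⌊θ⌋ : ℝ)| ≤ 1 := by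
        rw [abs_le]
        constructor <;> linarith [Int.floor_le θ, Int.lt_floor_add_one θ]
      calc |θ - (⌊θ⌋ : ℝ)| * N ≤ 1 * N := mul_le_mul_of_nonneg_right h1 hN0.le
        _ ≤ B ^ 10 := by linarith
        _ ≤ _ := hB10
  by_cases hmain : B < (N : ℝ) ^ (1 / 10 : ℝ) ∧ B ^ 2 ≤ N
  swap
  · -- trivial regime: `N ≤ B^{10}`
    refine htriv ?_
    rw [not_and_or] at hmain
    rcases hmain with h | h
    · have h' : (N : ℝ) ^ (1 / 10 : ℝ) ≤ B := not_lt.mp h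
      calc (N : ℝ) = ((N : ℝ) ^ (1 / 10 : ℝ)) ^ 10 := by
            rw [← Real.rpow_natCast, ← Real.rpow_mul hN0.le]; norm_num
        _ ≤ B ^ 10 := pow_le_pow_left₀ (Real.rpow_nonneg hN0.le _) h' 10
    · have h' : (N : ℝ) < B ^ 2 := not_le.mp h
      have : B ^ 2 ≤ B ^ 10 := pow_le_pow_right₀ (by linarith) (by norm_num)
      linarith
  -- main regime: Dirichlet with `Q = ⌊N/B²⌋`
  obtain ⟨hNB, hB2N⟩ := hmain
  set W : ℝ := B ^ 2 with hWdef
  have hW1 : 1 ≤ W := by rw [hWdef]; nlinarith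
  have hW0 : 0 < W := by linarith
  set n : ℕ := ⌊(N : ℝ) / W⌋₊ with hndef
  have hNW1 : 1 ≤ (N : ℝ) / W := by rw [le_div_iff₀ hW0]; linarith
  have hn1 : 1 ≤ n := by
    rw [hndef]; exact Nat.le_floor (by exact_mod_cast hNW1)
  have hn0 : 0 < n := hn1
  have hnle : (n : ℝ) ≤ N / W := Nat.floor_le (by positivity)
  have hnlt : (N : ℝ) / W < n + 1 := Nat.lt_floor_add_one _
  obtain ⟨r, hr, hrn⟩ := Real.exists_rat_abs_sub_le_and_den_le θ hn0
  set q : ℕ := r.den with hqdef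
  set a : ℤ := r.num with hadef
  have hq1 : 1 ≤ q := r.den_pos
  have hq0 : (0 : ℝ) < q := by exact_mod_cast hq1
  have hra : (r : ℝ) = a / q := by rw [hadef, hqdef]; exact Rat.cast_def r
  have hcop : IsCoprime a (q : ℤ) := by
    rw [Int.isCoprime_iff_gcd_eq_one, hadef, hqdef]
    exact r.reduced
  have hqn : (q : ℝ) ≤ n := by exact_mod_cast hrn
  have hθ1 : |θ - a / q| ≤ 1 / ((n + 1) * q) := by rw [← hra]; exact hr
  have hα : |θ - a / q| ≤ 1 / (q : ℝ) ^ 2 := by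
    refine hθ1.trans ?_
    rw [sq]
    refine one_div_le_one_div_of_le (by positivity) ?_
    exact mul_le_mul_of_nonneg_right (by linarith) hq0.le
  have hqNr : (q : ℝ) ≤ N := by
    refine hqn.trans (hnle.trans ?_)
    exact div_le_self hN0.le hW1
  have hqN : q ≤ N := by exact_mod_cast hqNr
  have hV := norm_afExpSum_moebius_le hq1 hcop hα hN hqN
  by_cases hqW : (q : ℝ) ≤ W
  · -- output this `q`
    refine ⟨q, a, hq1, ?_, ?_⟩
    · calc (q : ℝ) ≤ W := hqW
        _ = B ^ 2 := rfl
        _ ≤ B ^ 10 := pow_le_pow_right₀ (by linarith) (by norm_num)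
        _ ≤ _ := hB10
    · have h1 : |θ - a / q| ≤ W / N := by
        refine hθ1.trans ?_
        rw [div_le_div_iff₀ (by positivity) hN0]
        have h2 : (N : ℝ) < W * (n + 1) := by rwa [div_lt_iff₀ hW0, mul_comm] at hnlt
        have h3 : W * (n + 1) ≤ W * ((n + 1) * q) := by
          refine mul_le_mul_of_nonneg_left ?_ hW0.le
          have : (1 : ℝ) ≤ q := by exact_mod_cast hq1
          nlinarith
        linarith
      refine h1.trans (div_le_div_of_nonneg_right ?_ hN0.le)
      calc W = B ^ 2 := rfl
        _ ≤ B ^ 10 := pow_le_pow_right₀ (by linarith) (by norm_num)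
        _ ≤ _ := hB10
  · -- `q > W`: the minor-arc bound contradicts `‖S‖ ≥ δN`
    exfalso
    have hqW' : W < q := not_le.mp hqW
    -- `√q > B`
    have hsq : B < Real.sqrt q := by
      rw [show B = Real.sqrt W by rw [hWdef, Real.sqrt_sq hB0.le]]
      exact Real.sqrt_lt_sqrt hW0.le hqW'
    have hsq0 : 0 < Real.sqrt q := Real.sqrt_pos.2 hq0
    -- the three terms are `< N/B`, `< N/B`, `≤ N/B`
    have ht1 : (N : ℝ) / Real.sqrt q < N / B := div_lt_div_of_pos_left hN0 hB0 hsq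
    have ht2 : (N : ℝ) ^ (9 / 10 : ℝ) < N / B := by
      rw [lt_div_iff₀ hB0]
      have h1 : (N : ℝ) ^ (9 / 10 : ℝ) * (N : ℝ) ^ (1 / 10 : ℝ) = N := by
        rw [← Real.rpow_add hN0]; norm_num
      calc (N : ℝ) ^ (9 / 10 : ℝ) * B < (N : ℝ) ^ (9 / 10 : ℝ) * (N : ℝ) ^ (1 / 10 : ℝ) :=
            mul_lt_mul_of_pos_left hNB (Real.rpow_pos_of_pos hN0 _)
        _ = N := h1
    have ht3 : Real.sqrt N * Real.sqrt q ≤ N / B := by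
      have h1 : (q : ℝ) ≤ N / W := hqn.trans hnle
      have h2 : Real.sqrt q ≤ Real.sqrt N / B := by
        calc Real.sqrt q ≤ Real.sqrt (N / W) := Real.sqrt_le_sqrt h1
          _ = Real.sqrt N / B := by rw [Real.sqrt_div hN0.le, hWdef, Real.sqrt_sq hB0.le]
      calc Real.sqrt N * Real.sqrt q ≤ Real.sqrt N * (Real.sqrt N / B) :=
            mul_le_mul_of_nonneg_left h2 (Real.sqrt_nonneg _)
        _ = N / B := by rw [mul_div_assoc', Real.mul_self_sqrt hN0.le]
    have hsum : (N : ℝ) / Real.sqrt q + (N : ℝ) ^ (9 / 10 : ℝ) + Real.sqrt N * Real.sqrt q <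
        3 * (N / B) := by linarith
    have hL4 : L ^ 4 ≤ (1 + L) ^ 4 := pow_le_pow_left₀ hL0 (by linarith) 4
    have hNB3 : 4096 * L ^ 4 * (3 * (N / B)) ≤ 3 / 4 * (δ * N) := by
      rw [hBdef]
      have e : 4096 * L ^ 4 * (3 * ((N : ℝ) / (16384 * (1 + L) ^ 4 / δ))) =
          3 / 4 * (δ * N) * (L ^ 4 / (1 + L) ^ 4) := by
        field_simp
        ring
      rw [e]
      have h1 : L ^ 4 / (1 + L) ^ 4 ≤ 1 := by
        rw [div_le_one (by positivity)]; exact hL4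
      have h2 : 0 ≤ 3 / 4 * (δ * N) := by positivity
      exact mul_le_of_le_one_right h2 h1
    have hlt : ‖afExpSum (fun n => (μ n : ℝ)) N θ‖ < δ * N := by
      calc ‖afExpSum (fun n => (μ n : ℝ)) N θ‖
          ≤ 4096 * L ^ 4 * (N / Real.sqrt q + (N : ℝ) ^ (9 / 10 : ℝ) + Real.sqrt N * Real.sqrt q) := hV
        _ < 4096 * L ^ 4 * (3 * (N / B)) := by
            refine mul_lt_mul_of_pos_left hsum ?_
            have : 0 < L := by linarith
            positivity
        _ ≤ 3 / 4 * (δ * N) := hNB3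
        _ < δ * N := by
            have : 0 < δ * N := by positivity
            linarith
    exact absurd hS (not_le.mpr hlt)

end Literature.NumberTheory.Sieve.MoebiusExpSum
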